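import Literature.AlgebraicGeometry.Motives.ClosedSubschemeCohomologySequence
import Literature.AlgebraicGeometry.Motives.ClosedSubschemeRestrictionSequence
import Literature.AlgebraicGeometry.Modules.PullbackAlgebraUnit
import Literature.AlgebraicGeometry.Modules.ExtensionContraction
import HarnessLib

/-!
# The two restrictions `Hⁿ(X, 𝒪_X) → Hⁿ(Z, 𝒪_Z)` along a closed immersion agree:
# `ι♯`-restriction (`ClosedSubschemeCohomologySequence`) = `η_{𝒪_X}`-restriction (`ClosedSubschemeRestrictionSequence`)
# followed by `Hⁿ` of the canonical isomorphism `ι^*𝒪_X ≅ 𝒪_Z` (The Stacks Project, Tag 01AK; Hartshorne II.5, III 2.10)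

Layer `Literature/AlgebraicGeometry/Motives` (literature-typing tranche LT-H1 «semiregularity consumers», cell `pub-hsemireg`,
width seat lit-4 g6; second file). Everything PROVED; no definition, no named fact, no `instance`, no notation (net debt 0).

The lit-4 g5 files type the restriction to a closed subscheme `ι : Z ⟶ X` twice:
* `Motives/ClosedSubschemeCohomologySequence.lean` — for the structure sheaf, through the ALGEBRA UNIT
  `ι♯ : 𝒪_X ⟶ ι_*𝒪_Z` (tree `Modules.algebraUnit`): `restrictCohomology ι n : Hⁿ(X, 𝒪_X) →+ Hⁿ(Z, 𝒪_Z)`;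
* `Motives/ClosedSubschemeRestrictionSequence.lean` — for any module `F`, through the ADJUNCTION UNIT
  `η_F : F ⟶ ι_*ι^*F` (tree `Modules.pullbackUnit`): `restrictCohomologyOf ι F n : Hⁿ(X, F) →+ Hⁿ(Z, ι^*F)`;
and the second file records (HONEST SCOPE there) that no comparison of the two is asserted. This file supplies it:

1. `pullbackUnit_comp_pushforward_map_pullbackObjUnitToUnit` — **`η_{𝒪_X} ≫ ι_*(e) = ι♯`**, where
   `e : ι^*𝒪_X ⟶ 𝒪_Z` is Mathlib's canonical map `SheafOfModules.pullbackObjUnitToUnit` (the transpose of `ι♯`; an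
   ISOMORPHISM, tree `Modules.isIso_pullback_map_algebraUnit_comp_counit` ∕ Mathlib's instance): [StacksProject, Tag 01AK]
   «`f^*𝒪_Y = 𝒪_X`», [Hartshorne1977, II.5 p. 110] (`f^*` left adjoint to `f_*`).
2. **`restrictCohomology_eq_map_restrictCohomologyOf`** — `restrictCohomology ι n = Hⁿ(Z, e) ∘ restrictCohomologyOf ι 𝒪_X n`
   (naturality of the canonical isomorphism of [Hartshorne1977, III Lemma 2.10] in the module, item 1, functoriality of `Hⁿ`).
3. `isIso_pullbackObjUnitToUnit`, `map_pullbackObjUnitToUnit_bijective` — `Hⁿ(Z, e)` is bijective; hence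
   `restrictCohomology_surjective_iff`, `restrictCohomology_injective_iff`, `restrictCohomology_bijective_iff`,
   `restrictCohomology_eq_zero_iff` — every surjectivity ∕ injectivity ∕ vanishing statement transfers between the two files.
4. **`extClass_idealMulPullbackUnitComplexAb_unitModule`** — the two short exact sequences of abelian sheaves
   `0 → 𝓘_Z·𝒪_X → 𝒪_X —η→ ι_*ι^*𝒪_X → 0` and `0 → 𝓘_Z → 𝒪_X —ι♯→ ι_*𝒪_Z → 0` have the SAME first map (the tree's
   `idealSheafOf ι` is `idealMul 𝒪_X ι.ker` by definition) and are joined by the morphism `(𝟙, 𝟙, ι_*(e))` (item 1), so their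
   extension classes agree up to `ι_*(e)` (Mathlib `ShortComplex.ShortExact.extClass_naturality`; [Hartshorne1977, III Thm. 1.1A (d)]);
   hence **`pullbackUnitδ_unitModule_eq_closedSubschemeδ_map`**: `pullbackUnitδ ι 𝒪_X n = closedSubschemeδ ι n ∘ Hⁿ(Z, e)` (with
   `𝒪_X` finite locally free by the tree's `Modules.isFiniteLocallyFree_unitModule`), `_eq_comp`, and the transfers
   `pullbackUnitδ_unitModule_injective_iff`, `pullbackUnitδ_unitModule_eq_zero_iff`.

HONEST SCOPE: bookkeeping only — the adjunction `ι^* ⊣ ι_*`, Lemma 2.10 and the naturality of `δ`; no statement beyond the two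
parent files is made about `X`, `Z` or `ι` (any closed immersion of schemes). Grade REFEREED (Stacks ∕ GTM 52); each declaration is
tagged with the printed statement it transports.

## References

* [StacksProject] The Stacks Project, Tag 01AK (`f^*𝒪_Y = 𝒪_X`), Tag 0BVH (the algebra unit `𝒪_Y → f_*𝒪_X`).
* [Hartshorne1977] R. Hartshorne, *Algebraic Geometry*, GTM 52 (1977): II.5 p. 110 (`f^*`, `f_*`, adjunction), III Thm. 1.1A
  (c)–(d) p. 204 (the connecting morphisms and their naturality), III Lemma 2.10 and Remark 2.10.1 p. 209, III Ex. 5.5 (a) p. 231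
  («the natural map `H⁰(X, 𝒪_X) → H⁰(Y, 𝒪_Y)`»).
* [Hartshorne2010] R. Hartshorne, *Deformation Theory*, GTM 257 (2010): Ex. 6.7 (b) p. 52 (`δ : H¹(𝓛_Y) → H²(𝒪_X)`).

## Design notes

* Reused by name: `Motives.restrictCohomology`, `modulesPushforwardCohomologyEquiv_restrictCohomology`
  (`ClosedSubschemeCohomologySequence`); `Motives.restrictCohomologyOf`, `modulesPushforwardCohomologyEquiv_restrictCohomologyOf`
  (`ClosedSubschemeRestrictionSequence`); `Motives.modulesPushforwardCohomologyEquiv(_map)` (`PushforwardClosedEmbeddingCohomology`);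
  `Modules.algebraUnit`, `algebraUnit_eq_unitToPushforwardObjUnit`, `pullback_map_algebraUnit_comp_counit`,
  `isIso_pullback_map_algebraUnit_comp_counit` (`Modules/PullbackAlgebraUnit`, `Modules/PushforwardTrace`); `Modules.pullbackUnit`
  (`Modules/PullbackUnitSections`); Mathlib `SheafOfModules.pullbackObjUnitToUnit`,
  `pullbackPushforwardAdjunction_homEquiv_pullbackObjUnitToUnit`, `Adjunction.homEquiv_unit`, `Sheaf.H.map_comp_apply`,
  `Sheaf.H.map_id_apply`, `ShortComplex.homMk`, `Functor.mapShortComplex`, `ShortComplex.ShortExact.extClass_naturality`,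
  `Ext.comp_mk₀_id`, `Ext.comp_assoc_of_second_deg_zero`; `Motives.closedSubschemeδ(_apply)`, `shortExact_idealSheafShortComplexAb`
  (`ClosedSubschemeCohomologySequence`), `Motives.pullbackUnitδ(_apply)`, `shortExact_idealMulPullbackUnitComplexAb`
  (`ClosedSubschemeRestrictionSequence`), `Modules.idealMulPullbackUnitComplex` (`PullbackClosedImmersionIdealMul`),
  `Modules.idealSheafShortComplex` (`IdealSheafOfClosedImmersion`), `Modules.isFiniteLocallyFree_unitModule` (`ExtensionContraction`).
  No new definition: the canonical map is Mathlib's, spelled out with named implicit objects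
  (`.map (X := ι^*𝒪_X) (Y := 𝒪_Z) e`) so that the parents' lemmas rewrite syntactically; one `erw` (the functor `modulesToSheaf` is a
  `def` over `SheafOfModules.toSheaf`, so `𝟙` of its image object is only definitionally the parent's `𝟙`).
-/

noncomputable section

-- `TopCat.Presheaf`/`Scheme.Modules` are not reducible (as in Mathlib's `AlgebraicGeometry/Modules/Sheaf.lean` and the parents).
set_option backward.isDefEq.respectTransparency false

open CategoryTheory Limits Opposite TopologicalSpace Abelian AlgebraicGeometry

universe u

namespace Literature.AlgebraicGeometry.Motives

open Literature.AlgebraicGeometry.Modules Literature.AlgebraicGeometry.HodgeTheory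

variable {Z X : Scheme.{u}} (ι : Z ⟶ X)

/-! ## §1 `η_{𝒪_X} ≫ ι_*(e) = ι♯` for the canonical `e : ι^*𝒪_X ⟶ 𝒪_Z` -/

/-- **`η_{𝒪_X} ≫ ι_*(e) = ι♯`**: the adjunction unit at `𝒪_X` followed by `ι_*` of Mathlib's canonical map
`e : ι^*𝒪_X ⟶ 𝒪_Z` (`SheafOfModules.pullbackObjUnitToUnit`, the transpose of `ι♯`) is the algebra unit `ι♯ : 𝒪_X ⟶ ι_*𝒪_Z`
(any morphism `ι`; `adj.homEquiv` of the transpose). [cite: StacksProject, Tag 01AK (`f^*𝒪_Y = 𝒪_X`)]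
[cite: Hartshorne1977, II.5 (p. 110): "`f_*` and `f^*` are adjoint functors"] -/
theorem pullbackUnit_comp_pushforward_map_pullbackObjUnitToUnit :
    pullbackUnit ι (unitModule X) ≫
        (Scheme.Modules.pushforward ι).map (SheafOfModules.pullbackObjUnitToUnit ι.toRingCatSheafHom :
          (Scheme.Modules.pullback ι).obj (unitModule X) ⟶ unitModule Z) =
      algebraUnit ι := by
  rw [algebraUnit_eq_unitToPushforwardObjUnit,
    ← SheafOfModules.pullbackPushforwardAdjunction_homEquiv_pullbackObjUnitToUnit, Adjunction.homEquiv_unit]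
  rfl

/-- The canonical map `e : ι^*𝒪_X ⟶ 𝒪_Z` is an isomorphism (`ι^*𝒪_X = 𝒪_Z`; the tree's
`isIso_pullback_map_algebraUnit_comp_counit` through `pullback_map_algebraUnit_comp_counit`). The same proposition is the tree's
`FormalGeometry.WittGrothendieckExistence.FormalVectorBundlesAlgebraize.isIso_pullbackObjUnitToUnit`
(`FormalGeometry/WittGEPullbackUnitSections.lean`, via `final_opensMap`); it is re-derived here in three lines from
`Modules/PullbackAlgebraUnit`, which this layer already imports, to keep the `Motives` cone free of the `FormalGeometry` import.
[cite: StacksProject, Tag 01AK (`f^*𝒪_Y = 𝒪_X`)] -/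
theorem isIso_pullbackObjUnitToUnit : IsIso (SheafOfModules.pullbackObjUnitToUnit ι.toRingCatSheafHom) := by
  rw [← pullback_map_algebraUnit_comp_counit]
  exact isIso_pullback_map_algebraUnit_comp_counit ι

/-- `Hⁿ(Z, e) : Hⁿ(Z, ι^*𝒪_X) → Hⁿ(Z, 𝒪_Z)` is bijective (`e` an isomorphism; functoriality of `Hⁿ`).
[cite: StacksProject, Tag 01AK (`f^*𝒪_Y = 𝒪_X`)] [cite: Hartshorne1977, III §2 Definition (derived functors are functors), p. 207] -/
theorem map_pullbackObjUnitToUnit_bijective (n : ℕ) :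
    Function.Bijective (Sheaf.H.map ((SheafOfModules.toSheaf Z.ringCatSheaf).map
      (X := (Scheme.Modules.pullback ι).obj (unitModule X)) (Y := unitModule Z)
      (SheafOfModules.pullbackObjUnitToUnit ι.toRingCatSheafHom)) n) := by
  haveI := isIso_pullbackObjUnitToUnit ι
  let e : (Scheme.Modules.pullback ι).obj (unitModule X) ≅ unitModule Z :=
    asIso (SheafOfModules.pullbackObjUnitToUnit ι.toRingCatSheafHom)
  have h1 : ∀ x, Sheaf.H.map ((SheafOfModules.toSheaf Z.ringCatSheaf).map e.inv) n
      (Sheaf.H.map ((SheafOfModules.toSheaf Z.ringCatSheaf).map e.hom) n x) = x := fun x => by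
    rw [← Sheaf.H.map_comp_apply, ← Functor.map_comp, e.hom_inv_id, CategoryTheory.Functor.map_id,
      Sheaf.H.map_id_apply]
  have h2 : ∀ y, Sheaf.H.map ((SheafOfModules.toSheaf Z.ringCatSheaf).map e.hom) n
      (Sheaf.H.map ((SheafOfModules.toSheaf Z.ringCatSheaf).map e.inv) n y) = y := fun y => by
    rw [← Sheaf.H.map_comp_apply, ← Functor.map_comp, e.inv_hom_id, CategoryTheory.Functor.map_id,
      Sheaf.H.map_id_apply]
  exact ⟨Function.LeftInverse.injective h1, Function.RightInverse.surjective h2⟩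

section ClosedImmersion

variable [IsClosedImmersion ι]

/-! ## §2 The comparison `restrictCohomology = Hⁿ(e) ∘ restrictCohomologyOf 𝒪_X` -/

/-- **The two restrictions agree**: for a closed immersion `ι : Z ⟶ X`,
`restrictCohomology ι n x = Hⁿ(Z, e) (restrictCohomologyOf ι 𝒪_X n x)` — `Φ⁻¹ ∘ Hⁿ(ι♯) = Hⁿ(e) ∘ Φ⁻¹ ∘ Hⁿ(η_{𝒪_X})` by
`η ≫ ι_*e = ι♯` and the naturality of the canonical isomorphism `Φ` of Lemma 2.10 in the module.
[cite: Hartshorne1977, III Lemma 2.10 and Remark 2.10.1, p. 209] [cite: Hartshorne1977, III Ex. 5.5 (a), p. 231 («the natural map»)]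
[cite: StacksProject, Tag 01AK (`f^*𝒪_Y = 𝒪_X`)] -/
theorem restrictCohomology_eq_map_restrictCohomologyOf (n : ℕ) (x : structureSheafCohomology X n) :
    restrictCohomology ι n x =
      Sheaf.H.map ((SheafOfModules.toSheaf Z.ringCatSheaf).map
          (X := (Scheme.Modules.pullback ι).obj (unitModule X)) (Y := unitModule Z)
          (SheafOfModules.pullbackObjUnitToUnit ι.toRingCatSheafHom)) n
        (restrictCohomologyOf ι (unitModule X) n x) := by
  apply (modulesPushforwardCohomologyEquiv ι (unitModule Z) n).injective
  rw [modulesPushforwardCohomologyEquiv_restrictCohomology, modulesPushforwardCohomologyEquiv_map,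
    modulesPushforwardCohomologyEquiv_restrictCohomologyOf, ← Sheaf.H.map_comp_apply, ← Functor.map_comp,
    pullbackUnit_comp_pushforward_map_pullbackObjUnitToUnit]

/-- The comparison as an identity of homomorphisms. [cite: Hartshorne1977, III Lemma 2.10 and Remark 2.10.1, p. 209] -/
theorem restrictCohomology_eq_comp (n : ℕ) :
    restrictCohomology ι n =
      (Sheaf.H.map ((SheafOfModules.toSheaf Z.ringCatSheaf).map
          (X := (Scheme.Modules.pullback ι).obj (unitModule X)) (Y := unitModule Z)
          (SheafOfModules.pullbackObjUnitToUnit ι.toRingCatSheafHom)) n).comp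
        (restrictCohomologyOf ι (unitModule X) n) :=
  AddMonoidHom.ext fun x => restrictCohomology_eq_map_restrictCohomologyOf ι n x

/-! ## §3 Transfer of surjectivity ∕ injectivity ∕ vanishing between the two restrictions -/

/-- `Hⁿ(X, 𝒪_X) → Hⁿ(Z, 𝒪_Z)` (via `ι♯`) is surjective iff `Hⁿ(X, 𝒪_X) → Hⁿ(Z, ι^*𝒪_X)` (via `η`) is.
[cite: Hartshorne1977, III Lemma 2.10 and Remark 2.10.1, p. 209] [cite: StacksProject, Tag 01AK (`f^*𝒪_Y = 𝒪_X`)] -/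
theorem restrictCohomology_surjective_iff (n : ℕ) :
    Function.Surjective (restrictCohomology ι n) ↔ Function.Surjective (restrictCohomologyOf ι (unitModule X) n) := by
  constructor
  · intro h z
    obtain ⟨x, hx⟩ := h (Sheaf.H.map ((SheafOfModules.toSheaf Z.ringCatSheaf).map
      (X := (Scheme.Modules.pullback ι).obj (unitModule X)) (Y := unitModule Z)
      (SheafOfModules.pullbackObjUnitToUnit ι.toRingCatSheafHom)) n z)
    refine ⟨x, (map_pullbackObjUnitToUnit_bijective ι n).1 ?_⟩
    rw [← restrictCohomology_eq_map_restrictCohomologyOf, hx]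
  · intro h y
    obtain ⟨z, rfl⟩ := (map_pullbackObjUnitToUnit_bijective ι n).2 y
    obtain ⟨x, rfl⟩ := h z
    exact ⟨x, restrictCohomology_eq_map_restrictCohomologyOf ι n x⟩

/-- `Hⁿ(X, 𝒪_X) → Hⁿ(Z, 𝒪_Z)` (via `ι♯`) is injective iff `Hⁿ(X, 𝒪_X) → Hⁿ(Z, ι^*𝒪_X)` (via `η`) is.
[cite: Hartshorne1977, III Lemma 2.10 and Remark 2.10.1, p. 209] [cite: StacksProject, Tag 01AK (`f^*𝒪_Y = 𝒪_X`)] -/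
theorem restrictCohomology_injective_iff (n : ℕ) :
    Function.Injective (restrictCohomology ι n) ↔ Function.Injective (restrictCohomologyOf ι (unitModule X) n) := by
  constructor
  · intro h x₁ x₂ hx
    apply h
    rw [restrictCohomology_eq_map_restrictCohomologyOf, restrictCohomology_eq_map_restrictCohomologyOf, hx]
  · intro h x₁ x₂ hx
    apply h
    apply (map_pullbackObjUnitToUnit_bijective ι n).1
    rw [← restrictCohomology_eq_map_restrictCohomologyOf, ← restrictCohomology_eq_map_restrictCohomologyOf, hx]

/-- `Hⁿ(X, 𝒪_X) → Hⁿ(Z, 𝒪_Z)` (via `ι♯`) is bijective iff `Hⁿ(X, 𝒪_X) → Hⁿ(Z, ι^*𝒪_X)` (via `η`) is.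
[cite: Hartshorne1977, III Lemma 2.10 and Remark 2.10.1, p. 209] [cite: StacksProject, Tag 01AK (`f^*𝒪_Y = 𝒪_X`)] -/
theorem restrictCohomology_bijective_iff (n : ℕ) :
    Function.Bijective (restrictCohomology ι n) ↔ Function.Bijective (restrictCohomologyOf ι (unitModule X) n) :=
  and_congr (restrictCohomology_injective_iff ι n) (restrictCohomology_surjective_iff ι n)

/-- `Hⁿ(X, 𝒪_X) → Hⁿ(Z, 𝒪_Z)` (via `ι♯`) vanishes iff `Hⁿ(X, 𝒪_X) → Hⁿ(Z, ι^*𝒪_X)` (via `η`) does — the form consumed by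
`pullbackUnitδ_injective_iff` of `ClosedSubschemeRestrictionSequence`. [cite: Hartshorne1977, III Lemma 2.10 and Remark 2.10.1, p. 209]
[cite: StacksProject, Tag 01AK (`f^*𝒪_Y = 𝒪_X`)] -/
theorem restrictCohomology_eq_zero_iff (n : ℕ) :
    restrictCohomology ι n = 0 ↔ restrictCohomologyOf ι (unitModule X) n = 0 := by
  constructor
  · intro h
    ext x
    apply (map_pullbackObjUnitToUnit_bijective ι n).1
    rw [← restrictCohomology_eq_map_restrictCohomologyOf, h, AddMonoidHom.zero_apply, AddMonoidHom.zero_apply, map_zero]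
  · intro h
    ext x
    rw [restrictCohomology_eq_map_restrictCohomologyOf, h, AddMonoidHom.zero_apply, map_zero, AddMonoidHom.zero_apply]

/-! ## §4 The connecting homomorphisms agree: `pullbackUnitδ ι 𝒪_X = closedSubschemeδ ι ∘ Hⁿ(Z, e)` -/

/-- **The extension classes agree up to `ι_*(e)`**: the class of `0 → 𝓘_Z·𝒪_X → 𝒪_X —η→ ι_*ι^*𝒪_X → 0`
(`ClosedSubschemeRestrictionSequence`, `F = 𝒪_X`) is `ι_*(e)` followed by the class of `0 → 𝓘_Z → 𝒪_X —ι♯→ ι_*𝒪_Z → 0`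
(`ClosedSubschemeCohomologySequence`): the two short exact sequences of abelian sheaves are joined by the morphism
`(𝟙, 𝟙, ι_*(e))` (same first two objects and first map — `idealSheafOf ι` IS `idealMul 𝒪_X ι.ker` —, `η ≫ ι_*e = ι♯`), and
extension classes are natural (Mathlib `ShortComplex.ShortExact.extClass_naturality`).
[cite: Hartshorne1977, III Thm. 1.1A (d) (naturality of δ for a morphism of short exact sequences), p. 204]
[cite: StacksProject, Tag 01AK (`f^*𝒪_Y = 𝒪_X`)] -/
theorem extClass_idealMulPullbackUnitComplexAb_unitModule :
    (shortExact_idealMulPullbackUnitComplexAb ι (isFiniteLocallyFree_unitModule (X := X))).extClass =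
      (Ext.mk₀ ((SheafOfModules.toSheaf X.ringCatSheaf).map ((Scheme.Modules.pushforward ι).map
        (X := (Scheme.Modules.pullback ι).obj (unitModule X)) (Y := unitModule Z)
        (SheafOfModules.pullbackObjUnitToUnit ι.toRingCatSheafHom)))).comp
        (shortExact_idealSheafShortComplexAb ι).extClass (zero_add 1) := by
  let φ : idealMulPullbackUnitComplex ι (unitModule X) ⟶ idealSheafShortComplex ι :=
    ShortComplex.homMk (𝟙 _) (𝟙 _)
      ((Scheme.Modules.pushforward ι).map (X := (Scheme.Modules.pullback ι).obj (unitModule X)) (Y := unitModule Z)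
        (SheafOfModules.pullbackObjUnitToUnit ι.toRingCatSheafHom))
      (by rw [Category.id_comp, Category.comp_id])
      (by rw [Category.id_comp]; exact (pullbackUnit_comp_pushforward_map_pullbackObjUnitToUnit ι).symm)
  have h := ShortComplex.ShortExact.extClass_naturality
    (shortExact_idealMulPullbackUnitComplexAb ι (isFiniteLocallyFree_unitModule (X := X)))
    (shortExact_idealSheafShortComplexAb ι) ((modulesToSheaf X).mapShortComplex.map φ)
  have h1 : ((modulesToSheaf X).mapShortComplex.map φ).τ₁ = 𝟙 _ := (modulesToSheaf X).map_id _
  erw [h1, Ext.comp_mk₀_id] at h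
  exact h

/-- **The connecting homomorphisms agree**: for a closed immersion `ι : Z ⟶ X` and `w ∈ Hⁿ(Z, ι^*𝒪_X)`,
`pullbackUnitδ ι 𝒪_X n w = closedSubschemeδ ι n (Hⁿ(Z, e) w)` — `δ` of the `η`-sequence is `δ` of the `ι♯`-sequence after the
canonical identification `ι^*𝒪_X ≅ 𝒪_Z` (naturality of `δ`, [Hartshorne1977, III Thm. 1.1A (d)], and of the Lemma 2.10 isomorphism).
[cite: Hartshorne1977, III Thm. 1.1A (d), p. 204] [cite: Hartshorne1977, III Lemma 2.10 and Remark 2.10.1, p. 209] -/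
theorem pullbackUnitδ_unitModule_eq_closedSubschemeδ_map (n : ℕ)
    (w : Sheaf.H ((SheafOfModules.toSheaf Z.ringCatSheaf).obj ((Scheme.Modules.pullback ι).obj (unitModule X))) n) :
    pullbackUnitδ ι (isFiniteLocallyFree_unitModule (X := X)) n w =
      closedSubschemeδ ι n (Sheaf.H.map ((SheafOfModules.toSheaf Z.ringCatSheaf).map
          (X := (Scheme.Modules.pullback ι).obj (unitModule X)) (Y := unitModule Z)
          (SheafOfModules.pullbackObjUnitToUnit ι.toRingCatSheafHom)) n w) := by
  rw [pullbackUnitδ_apply, closedSubschemeδ_apply, modulesPushforwardCohomologyEquiv_map,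
    extClass_idealMulPullbackUnitComplexAb_unitModule]
  change _ = ((modulesPushforwardCohomologyEquiv ι ((Scheme.Modules.pullback ι).obj (unitModule X)) n w).comp
      (Ext.mk₀ ((SheafOfModules.toSheaf X.ringCatSheaf).map ((Scheme.Modules.pushforward ι).map
        (X := (Scheme.Modules.pullback ι).obj (unitModule X)) (Y := unitModule Z)
        (SheafOfModules.pullbackObjUnitToUnit ι.toRingCatSheafHom)))) (add_zero n)).comp
      (shortExact_idealSheafShortComplexAb ι).extClass rfl
  rw [Ext.comp_assoc_of_second_deg_zero]

/-- As homomorphisms: `pullbackUnitδ ι 𝒪_X n = closedSubschemeδ ι n ∘ Hⁿ(Z, e)`.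
[cite: Hartshorne1977, III Thm. 1.1A (d), p. 204] -/
theorem pullbackUnitδ_unitModule_eq_comp (n : ℕ) :
    pullbackUnitδ ι (isFiniteLocallyFree_unitModule (X := X)) n =
      (closedSubschemeδ ι n).comp (Sheaf.H.map ((SheafOfModules.toSheaf Z.ringCatSheaf).map
          (X := (Scheme.Modules.pullback ι).obj (unitModule X)) (Y := unitModule Z)
          (SheafOfModules.pullbackObjUnitToUnit ι.toRingCatSheafHom)) n) :=
  AddMonoidHom.ext fun w => pullbackUnitδ_unitModule_eq_closedSubschemeδ_map ι n w

/-- Transfer for `δ`: `pullbackUnitδ ι 𝒪_X n` is injective iff `closedSubschemeδ ι n` is (they differ by a bijection).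
[cite: Hartshorne1977, III Thm. 1.1A (d), p. 204] [cite: Hartshorne2010, Ex. 6.7 (b), p. 52] -/
theorem pullbackUnitδ_unitModule_injective_iff (n : ℕ) :
    Function.Injective (pullbackUnitδ ι (isFiniteLocallyFree_unitModule (X := X)) n) ↔
      Function.Injective (closedSubschemeδ ι n) := by
  rw [pullbackUnitδ_unitModule_eq_comp, AddMonoidHom.coe_comp]
  exact ⟨fun h => Function.Injective.of_comp_right h (map_pullbackObjUnitToUnit_bijective ι n).2,
    fun h => h.comp (map_pullbackObjUnitToUnit_bijective ι n).1⟩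

/-- Transfer for `δ`: `pullbackUnitδ ι 𝒪_X n = 0` iff `closedSubschemeδ ι n = 0`. [cite: Hartshorne1977, III Thm. 1.1A (d), p. 204] -/
theorem pullbackUnitδ_unitModule_eq_zero_iff (n : ℕ) :
    pullbackUnitδ ι (isFiniteLocallyFree_unitModule (X := X)) n = 0 ↔ closedSubschemeδ ι n = 0 := by
  constructor
  · intro h
    ext y
    obtain ⟨w, rfl⟩ := (map_pullbackObjUnitToUnit_bijective ι n).2 y
    rw [← pullbackUnitδ_unitModule_eq_closedSubschemeδ_map, h, AddMonoidHom.zero_apply, AddMonoidHom.zero_apply]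
  · intro h
    ext w
    rw [pullbackUnitδ_unitModule_eq_closedSubschemeδ_map, h, AddMonoidHom.zero_apply, AddMonoidHom.zero_apply]

end ClosedImmersion

end Literature.AlgebraicGeometry.Motives

end
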